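import Literature.NumberTheory.Weil1964.AdelicMetaplecticTransport
import Literature.NumberTheory.Weil1964.AdelicDoublingDiagonalLift
import Literature.NumberTheory.GelbartRogawski1991.UnitaryDualPairSplittingDatum
import HarnessLib

/-!
# The LINEAR relabelling `Λ = (x, y) ↦ (x, −y)` carries Weil's rational section of `Mp_ψ(W_{−T})` to that of `Mp_ψ(W_T)`

Topic `NumberTheory/Weil1964`; namespace `Literature.NumberTheory.Weil1964`.  KERNEL MATHEMATICS ONLY: theorems (no definition, no named
fact, no `sorry`).  The LINEAR twin of ✔ `AdelicMetaplecticRationalLiftConj` (there: the ANTI-linear conjugate model `(g, M) ↦ (g, C M C)` over the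
IDENTITY of `Sp(W_T)(𝔸) = Sp(W_{−T})(𝔸)`, rational matrices moved by `Λ = diag(1, −1)`); here: the relabelling of record
`adelicMpContRelabel F ι (−1) _ : Mp_ψ(W_{−T})ᶜᵒⁿᵗ ≃* Mp_ψ(W_T)ᶜᵒⁿᵗ`, `(g, M) ↦ (Λ g Λ⁻¹, M)` (✔ `AdelicMetaplecticTransport` §2: SAME operator,
symplectic component conjugated by the anti-isometry `Λ : (W, β_{−T}) ≃ (W, β_T)`), under which the rational matrix of a rational point DOES NOT
MOVE: `Λ (ratSp (−T) γ) Λ⁻¹ = ratSp T γ` (both are `(x′, y′) ↦ (a x′ + b T y′, T⁻¹ (c x′ + d T y′))`, `coe_transportSp_apply_blocks`).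

* `symplecticGroupCongr_relabelVec_negOne_ratSp` — that matrix identity;
* **`adelicMpContRelabel_negOne_ratThetaLiftCont`** — `relabel (r_{−T} γ) = r_T γ` for Weil's Θ-rigid rational lift `r = ratThetaLiftCont`, by
  Θ-RIGIDITY in `Mp_ψ(W_T)` (✔ `adelicMpRelabel_eq_of_proj_eq`: the relabelled pair fixes `Θ` — `adelicMpRelabel_mem_adelicMpTheta_iff` — and lies
  over `ratSp T γ`);
* the RANGE forms for [GelbartRogawski1991]'s section `i = ratSection` in both directions
  (`adelicMpContRelabel_negOne_mem_range_ratSection`, `adelicMpContRelabel_negOne_symm_mem_range_ratSection`) — the `ratPts` clause of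
  `SplittingDatum.IsCompatible` for a splitting transported along the relabelling (its `proj` clause is `adelicMpCont.proj_relabel`).

USE (pub-hodgecm2, RSCONJ row Ω, ROUTE C of `HOME/d2bridge/ident/ident-1/omega/OMEGA-ROUTE-C.md` §3 (K-c)): the θ-twist
`s′ := relabel⁻¹ ∘ s_a ∘ (ḡ, h̄)` of a compatible splitting at the line `⟨a⟩` is compatible at `⟨−a⟩`; this file is its rational-points half.

## References
* [Weil1964] A. Weil, *Sur certains groupes d'opérateurs unitaires*, Acta Math. 111 (1964), Chap. III n° 40 p. 190 (the section `r_k`), n° 41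
  Thm 6 p. 193 (its operators fix `Θ`).
* [MoeglinVignerasWaldspurger1987] C. Mœglin, M.-F. Vignéras, J.-L. Waldspurger, LNM 1291 (1987), Chap. 2 II.1 (transport of structure of `S̃p_ψ(W)`).
* [GelbartRogawski1991] S. Gelbart, J. Rogawski, Invent. Math. 105 (1991), §3.1 p. 454 L35–42 (`π` splits uniquely over `Sp_F(W)`; the splitting `i`).
* [Kudla1996] S. Kudla, *Notes on the local theta correspondence* (1996), V.3 (the space `W⁻`).
-/

set_option autoImplicit false

noncomputable section

namespace Literature.NumberTheory.Weil1964

open Matrix NumberField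
open Literature.RepresentationTheory.HeisenbergGroup Literature.RepresentationTheory.HeisenbergGroup.SymplecticMatrix
  Literature.NumberTheory.Automorphic
open Literature.NumberTheory.Automorphic.UnitaryGroup (symplecticGroupCongr coe_symplecticGroupCongr_apply)
open Literature.NumberTheory.GelbartRogawski1991.UnitaryDualPair (ratSection ratSection_apply)

variable (F : Type) [Field F] [NumberField F] {n : ℕ} (T : Matrix (Fin n) (Fin n) (AdeleRing (𝓞 F) F)) (hT : IsUnit T.det)
  {T' : Matrix (Fin n) (Fin n) (AdeleRing (𝓞 F) F)}
  (hC : T * (((-1 : GL (Fin n) (AdeleRing (𝓞 F) F)) : GL (Fin n) (AdeleRing (𝓞 F) F)) : Matrix (Fin n) (Fin n) (AdeleRing (𝓞 F) F)) = T')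
  (hnT : IsUnit T'.det)
/- (the relabelling hypothesis of record `hC : T · (−1) = T′` is kept GENERAL — `T′` need only be PROPOSITIONALLY `−T`, e.g. the Gram matrix of the
   pair at the line `⟨−a⟩` vs. minus that at `⟨a⟩` — and `hnT : IsUnit T′.det` is a separate hypothesis (for `T′ = −T` callers pass
   `SymplecticMatrix.isUnit_det_neg T hT` of ✔ `AdelicMetaplecticRationalLiftConj`); proofs `subst T′ = −T`.) -/

/-! ## §1 `Λ (ratSp (−T) γ) Λ⁻¹ = ratSp T γ`: the rational matrix does not move -/

/-- the relabelling hypothesis of record at `C = −1`: `T · (−1) = −T`. [folklore] -/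
private theorem mul_coe_negOne_GL : T * (((-1 : GL (Fin n) (AdeleRing (𝓞 F) F)) : GL (Fin n) (AdeleRing (𝓞 F) F)) :
    Matrix (Fin n) (Fin n) (AdeleRing (𝓞 F) F)) = -T := by
  rw [Units.val_neg, Units.val_one, Matrix.mul_neg, Matrix.mul_one]

/-- `(−1)⁻¹ = −1` in `GL_n(𝔸_F)`, on vectors: `(−1)⁻¹ y = −y`. [folklore] -/
private theorem coe_inv_negOne_GL_mulVec (y : Fin n → AdeleRing (𝓞 F) F) :
    (((-1 : GL (Fin n) (AdeleRing (𝓞 F) F))⁻¹ : GL (Fin n) (AdeleRing (𝓞 F) F)) : Matrix (Fin n) (Fin n) (AdeleRing (𝓞 F) F)) *ᵥ y = -y := by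
  rw [inv_neg, inv_one, Units.val_neg, Units.val_one, Matrix.neg_mulVec, Matrix.one_mulVec]

/-- `(−1) y = −y` in `GL_n(𝔸_F)`. [folklore] -/
private theorem coe_negOne_GL_mulVec (y : Fin n → AdeleRing (𝓞 F) F) :
    (((-1 : GL (Fin n) (AdeleRing (𝓞 F) F)) : GL (Fin n) (AdeleRing (𝓞 F) F)) : Matrix (Fin n) (Fin n) (AdeleRing (𝓞 F) F)) *ᵥ y = -y := by
  rw [Units.val_neg, Units.val_one, Matrix.neg_mulVec, Matrix.one_mulVec]

/-- the relabelled Gram matrix IS `−T`. [folklore] -/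
private theorem eq_neg_of_mul_coe_negOne_GL
    (hC : T * (((-1 : GL (Fin n) (AdeleRing (𝓞 F) F)) : GL (Fin n) (AdeleRing (𝓞 F) F)) : Matrix (Fin n) (Fin n) (AdeleRing (𝓞 F) F)) = T') :
    T' = -T := by
  rw [← hC, mul_coe_negOne_GL]

/-- `(−T)⁻¹ = −T⁻¹` (`T.det` a unit): the inverse Gram matrix of `W⁻` (as in ✔ `SymplecticMatrix.inv_neg_eq`). [cite: Kudla1996, V.3] -/
private theorem inv_neg_eq' (hT : IsUnit T.det) : (-T)⁻¹ = -T⁻¹ :=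
  Matrix.inv_eq_left_inv (by rw [neg_mul_neg, Matrix.nonsing_inv_mul T hT])

/-- **the rational symplectic matrix does not move under the linear relabelling**: `Λ (ratSp (−T) γ) Λ⁻¹ = ratSp T γ` for
`Λ = relabelVec (−1) : (x, y) ↦ (x, −y)` — both sides are `(x′, y′) ↦ (a x′ + b T y′, T⁻¹ (c x′ + d T y′))`.
[cite: Weil1964, Chap. III n° 46 p. 202] [cite: Kudla1996, V.3] -/
theorem symplecticGroupCongr_relabelVec_negOne_ratSp (γ : Matrix.symplecticGroup (Fin n) F) :
    symplecticGroupCongr _ _ (relabelVec F (Fin n) (-1)) (polar_relabelVec F (Fin n) (-1) hC)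
        (ratSp F T' hnT γ) = ratSp F T hT γ := by
  obtain rfl : T' = -T := eq_neg_of_mul_coe_negOne_GL F T hC
  refine Subtype.ext (LinearEquiv.ext fun v => ?_)
  obtain ⟨x', y'⟩ := v
  rw [coe_symplecticGroupCongr_apply, relabelVec_symm_apply, relabelVec_apply, coe_inv_negOne_GL_mulVec]
  dsimp only
  rw [ratSp, ratSp, MonoidHom.comp_apply, MonoidHom.comp_apply, coe_transportSp_apply_blocks, coe_transportSp_apply_blocks,
    inv_neg_eq' F T hT]
  simp only [Matrix.neg_mulVec, Matrix.mulVec_neg, neg_neg, coe_negOne_GL_mulVec]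

/-! ## §2 `relabel ∘ r_{−T} = r_T` for Weil's Θ-rigid rational lift -/

/-- **`relabel (r_{−T}(γ)) = r_T(γ)` in `Mp_ψ(W_T)`** for Weil's Θ-rigid rational lift `r = ratThetaLiftCont`: the relabelled pair has the same
operator, so it fixes `Θ` (`adelicMpRelabel_mem_adelicMpTheta_iff`), and it lies over `Λ (ratSp (−T) γ) Λ⁻¹ = ratSp T γ`; Θ-rigidity
(`adelicMpRelabel_eq_of_proj_eq`) identifies it. [cite: Weil1964, Chap. III n° 40 p. 190, n° 41 Thm 6 p. 193] [cite: MoeglinVignerasWaldspurger1987, Chap. 2 II.1] -/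
theorem adelicMpRelabel_negOne_ratThetaLiftCont (γ : Matrix.symplecticGroup (Fin n) F) :
    adelicMpRelabel F (Fin n) (-1) hC (ratThetaLiftCont F T' hnT γ : adelicMp F (Fin n) T') =
      (ratThetaLiftCont F T hT γ : adelicMp F (Fin n) T) :=
  adelicMpRelabel_eq_of_proj_eq F (Fin n) (-1) hC (mulVec_surjective_of_isUnit_det F T hT)
    (coe_ratThetaLiftCont_mem_adelicMpTheta F T' hnT γ) (coe_ratThetaLiftCont_mem_adelicMpTheta F T hT γ)
    ((proj_coe_ratThetaLiftCont F T hT γ).trans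
      ((symplecticGroupCongr_relabelVec_negOne_ratSp F T hT hC hnT γ).symm.trans
        (congrArg _ (proj_coe_ratThetaLiftCont F T' hnT γ).symm)))

/-- **`relabel (r_{−T}(γ)) = r_T(γ)` on the group of record** `Mp_ψ(W_𝔸)ᶜᵒⁿᵗ` (`adelicMpContRelabel`).
[cite: Weil1964, Chap. III n° 40 p. 190, n° 41 Thm 6 p. 193] [cite: GelbartRogawski1991, §3.1 p. 454] -/
theorem adelicMpContRelabel_negOne_ratThetaLiftCont (γ : Matrix.symplecticGroup (Fin n) F) :
    adelicMpContRelabel F (Fin n) (-1) hC (ratThetaLiftCont F T' hnT γ) =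
      ratThetaLiftCont F T hT γ :=
  Subtype.ext (adelicMpRelabel_negOne_ratThetaLiftCont F T hT hC hnT γ)

/-- the inverse direction: `relabel⁻¹ (r_T(γ)) = r_{−T}(γ)`. [cite: Weil1964, Chap. III n° 40 p. 190, n° 41 Thm 6 p. 193] -/
theorem adelicMpContRelabel_negOne_symm_ratThetaLiftCont (γ : Matrix.symplecticGroup (Fin n) F) :
    (adelicMpContRelabel F (Fin n) (-1) hC).symm (ratThetaLiftCont F T hT γ) =
      ratThetaLiftCont F T' hnT γ :=
  (MulEquiv.symm_apply_eq _).2 (adelicMpContRelabel_negOne_ratThetaLiftCont F T hT hC hnT γ).symm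

/-! ## §3 The range forms for [GelbartRogawski1991]'s section `i = ratSection` -/

section Range

variable {F T}

/-- `p ∈ range i_T → p ∈ range r_T` (as in ✔ `range_ratSection_eq`). [cite: GelbartRogawski1991, §3.1 p. 454 L40–42] -/
private theorem mem_range_lift_of_mem_range_section {T : Matrix (Fin n) (Fin n) (AdeleRing (𝓞 F) F)} {hT : IsUnit T.det}
    {p : adelicMpCont F (Fin n) T} (hp : p ∈ (ratSection F T hT).range) : p ∈ (ratThetaLiftCont F T hT).range := by
  obtain ⟨x, rfl⟩ := hp
  exact ⟨_, rfl⟩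

/-- `p ∈ range r_T → p ∈ range i_T` (as in ✔ `range_ratSection_eq`). [cite: GelbartRogawski1991, §3.1 p. 454 L40–42] -/
private theorem mem_range_section_of_mem_range_lift {T : Matrix (Fin n) (Fin n) (AdeleRing (𝓞 F) F)} {hT : IsUnit T.det}
    {p : adelicMpCont F (Fin n) T} (hp : p ∈ (ratThetaLiftCont F T hT).range) : p ∈ (ratSection F T hT).range := by
  obtain ⟨γ, rfl⟩ := hp
  exact ⟨⟨ratSp F T hT γ, γ, rfl⟩, ratSection_apply F T hT γ⟩

end Range

/-- `p ∈ range r_{−T} → relabel p ∈ range r_T`. [cite: Weil1964, Chap. III n° 40 p. 190, n° 41 Thm 6 p. 193] -/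
theorem adelicMpContRelabel_negOne_mem_range_ratThetaLiftCont {p : adelicMpCont F (Fin n) T'}
    (hp : p ∈ (ratThetaLiftCont F T' hnT).range) :
    adelicMpContRelabel F (Fin n) (-1) hC p ∈ (ratThetaLiftCont F T hT).range :=
  Exists.elim (MonoidHom.mem_range.1 hp) fun γ hγ =>
    MonoidHom.mem_range.2
      ⟨γ, (adelicMpContRelabel_negOne_ratThetaLiftCont F T hT hC hnT γ).symm.trans
        (congrArg (adelicMpContRelabel F (Fin n) (-1) hC) hγ)⟩

/-- `q ∈ range r_T → relabel⁻¹ q ∈ range r_{−T}`. [cite: Weil1964, Chap. III n° 40 p. 190, n° 41 Thm 6 p. 193] -/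
theorem adelicMpContRelabel_negOne_symm_mem_range_ratThetaLiftCont {q : adelicMpCont F (Fin n) T}
    (hq : q ∈ (ratThetaLiftCont F T hT).range) :
    (adelicMpContRelabel F (Fin n) (-1) hC).symm q ∈ (ratThetaLiftCont F T' hnT).range :=
  Exists.elim (MonoidHom.mem_range.1 hq) fun γ hγ =>
    MonoidHom.mem_range.2
      ⟨γ, (adelicMpContRelabel_negOne_symm_ratThetaLiftCont F T hT hC hnT γ).symm.trans
        (congrArg (adelicMpContRelabel F (Fin n) (-1) hC).symm hγ)⟩

/-- **the linear relabelling carries `i_{−T}(Sp_F(W⁻))` onto `i_T(Sp_F(W))`**: `p ∈ range i_{−T} → relabel p ∈ range i_T` — the `ratPts` clause of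
`SplittingDatum.IsCompatible` for a splitting transported along `adelicMpContRelabel (−1)` (its `proj` clause is `adelicMpCont.proj_relabel`).
[cite: GelbartRogawski1991, §3.1 Prop. 3.1.1 p. 455 L1–3, Remark p. 457 L4] [cite: Weil1964, Chap. III n° 41 Thm 6 p. 193] -/
theorem adelicMpContRelabel_negOne_mem_range_ratSection {p : adelicMpCont F (Fin n) T'}
    (hp : p ∈ (ratSection F T' hnT).range) :
    adelicMpContRelabel F (Fin n) (-1) hC p ∈ (ratSection F T hT).range :=
  mem_range_section_of_mem_range_lift
    (adelicMpContRelabel_negOne_mem_range_ratThetaLiftCont F T hT hC hnT (mem_range_lift_of_mem_range_section hp))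

/-- the inverse direction: `q ∈ range i_T → relabel⁻¹ q ∈ range i_{−T}`. [cite: GelbartRogawski1991, §3.1 Prop. 3.1.1 p. 455 L1–3] -/
theorem adelicMpContRelabel_negOne_symm_mem_range_ratSection {q : adelicMpCont F (Fin n) T}
    (hq : q ∈ (ratSection F T hT).range) :
    (adelicMpContRelabel F (Fin n) (-1) hC).symm q ∈ (ratSection F T' hnT).range :=
  mem_range_section_of_mem_range_lift
    (adelicMpContRelabel_negOne_symm_mem_range_ratThetaLiftCont F T hT hC hnT (mem_range_lift_of_mem_range_section hq))

end Literature.NumberTheory.Weil1964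

end
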